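import Mathlib.Analysis.SpecialFunctions.Pow.Real
import Summits.KontsevichZagierPeriods.KontsevichZagierPeriods.Theorems.SymplecticScissorsVolumeFormOffPlaneToricA
import Summits.KontsevichZagierPeriods.KontsevichZagierPeriods.Theorems.SymplecticScissorsVolumeFormOffPlaneLogBoxCut
import Summits.KontsevichZagierPeriods.KontsevichZagierPeriods.Theorems.SymplecticScissorsVolumeFormOffPlaneLogBoxLinear
import Summits.KontsevichZagierPeriods.KontsevichZagierPeriods.Theorems.MultiplicationAccessible.Negative.Core

/-!
# Crux `VolumeFormOffPlane` (stmt-KontsevichZagierPeriods-14935) — line `Sketch`,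
stub `stub_triToBox` (Hilbert's third problem for log-triangles, dimension 3)

Coordinates `x = p 0`, `y = p 1`, slack `z = p 2` with `0 < z ∧ z·(x·y) < 1`. The LOG-TRIANGLE
`T(a, b, i, j, c) = {a < x, b < y, xⁱ yʲ < c, slack}` is, in logarithmic coordinates
`u = log x, v = log y`, the right triangle `{u > log a, v > log b, i u + j v < log c}` of area
`(log g)² / (2 i j)`, `g = c / (aⁱ bʲ)`; the LOG-BOX over `(a, b)` with edge ratios `g` and
`g^{1/(2ij)}` has the same volume. `stub_triToBox`: GIVEN the four registered stubs
`stub_triExists` (representations exist), `stub_powerMove` (the monomial map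
`(x, y, z) ↦ (xⁱ, yʲ, z·xy/(xⁱyʲ))` is a rule-(2) move of Jacobian `i j`), `stub_inversionMove`
(the inversions `x ↦ A/x`, `y ↦ A/y` with the slack rescaled are rule-(2) moves, `|det| = 1`) and
`stub_squareSplit` (the log-square splits along `xy = g`), the two integrand-`1` representations
are KZ-equivalent. Chain, in `FormalRep ⧸ relations`:
`[T(a,b,i,j,c)] = [T(1,1,i,j,g)]` (diagonal move `diag(a, b, (ab)⁻¹)`),
`(ij)•[T(1,1,i,j,g)] = [T(1,1,1,1,g)]` (power move),
`[Q(g)] = [T(1,1,1,1,g)] + [NE(g)]` (split) and `[T(1,1,1,1,g)] = [MID(g)] = [NE(g)]` (two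
inversions with `A = g`), so `[Q(g)] = (2ij)•[T(1,1,i,j,g)]`; `[Q(g)] = (2ij)•[box(g, g^{1/(2ij)})]`
(box stacking, landed `toric_pow`); `FormalRep ⧸ relations` is torsion-free (landed
`MultiplicationAccessible.Negative.mem_relations_of_nsmul_mem_relations`); un-normalise by the
landed scaling move `stub_logBoxLinear`.

Sources: M. Kontsevich, D. Zagier, *Periods* (2001), §1.2 (the moves); the dissection is the
Hadwiger–Glur half-turn argument read through `exp`; bookkeeping folklore.
-/

noncomputable section

open MeasureTheory Set
open Literature.NumberTheory.Transcendental

namespace Summit.KontsevichZagierPeriods.SymplecticScissors.LogPolytope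

/-! ## A diagonal move on an arbitrary domain -/

/-- **Diagonal rescaling with `|det| = 1` is one rule-(2) move, on any domain.** For non-zero
real-algebraic `c_i` with `|∏ c_i| = 1`, the integrand-`1` representations on `σ` and on
`diag(c) σ = {q | (c_i⁻¹ q_i)_i ∈ σ}` satisfy `[r] − [r'] ∈ KZ.relations`. [folklore] -/
theorem ttb_diag_move {N : ℕ} (c : Fin N → ℝ) (hc0 : ∀ i, c i ≠ 0)
    (hca : ∀ i, IsAlgebraic ℚ (c i)) (hdet : |∏ i, c i| = 1) (r r' : KZ.IntegralRep N)
    (hd : r'.domain = {q | (fun i => (c i)⁻¹ * q i) ∈ r.domain})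
    (hr : ∀ p ∈ r.domain, r.integrand p = 1) (hr' : ∀ p ∈ r'.domain, r'.integrand p = 1) :
    KZ.of r - KZ.of r' ∈ KZ.relations := by
  have hd' : r'.domain = (LinearMap.toContinuousLinearMap (Matrix.toLin' (Matrix.diagonal c)) :
      (Fin N → ℝ) →L[ℝ] (Fin N → ℝ)) '' r.domain := by
    rw [hd, lbl_image_diag hc0]
  refine KZ.changeOfVariablesRel_subset_relations
    (KZ.of_sub_of_mem_changeOfVariablesRel_linear r r' _
      (lbl_isSemialgebraicMapOn_diag hca r.isSemialgebraic_domain)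
      (lbl_injective_diag hc0).injOn hd' fun x hx => ?_)
  rw [hr x hx, hr' _ (hd' ▸ mem_image_of_mem _ hx), lbl_det_diag, hdet, mul_one]

/-! ## Small algebraic facts -/

/-- `c / (aⁱ bʲ)` is algebraic for algebraic `a, b, c`. [folklore] -/
theorem ttb_isAlgebraic_ratio {a b c : ℝ} (ha : IsAlgebraic ℚ a) (hb : IsAlgebraic ℚ b)
    (hc : IsAlgebraic ℚ c) (i j : ℕ) : IsAlgebraic ℚ (c / (a ^ i * b ^ j)) := by
  rw [div_eq_mul_inv]
  exact hc.mul ((ha.pow i).mul (hb.pow j)).inv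

/-- In an additive commutative group, `2 • ((i * j) • x) = (2 * i * j) • x`. [folklore] -/
theorem ttb_two_nsmul_nsmul {G : Type*} [AddCommGroup G] (i j : ℕ) (x : G) :
    2 • ((i * j) • x) = (2 * i * j) • x := by
  rw [smul_smul, mul_assoc]

/-! ## The stub -/

/-- **Stub (lead; Hilbert's third problem for log-triangles).** Given the four stubs
`stub_triExists`, `stub_powerMove`, `stub_inversionMove`, `stub_squareSplit`: for `a, b > 0`,
`c` real algebraic, `i, j ≥ 1`, `aⁱbʲ < c`, the log-triangle `{a < x, b < y, xⁱyʲ < c}` is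
KZ-equivalent to the log-box `{a < x < a·g, b < y < b·g^{1/(2ij)}}`, `g = c/(aⁱbʲ)` (both with
the slack `0 < z < 1/(xy)`): normalise to `a = b = 1` (diagonal move), `(ij)•[T_{ij}(g)] = [T_{11}(g)]`
(power move), `2•[T_{11}(g)] = [Q(g)]` (split + two inversions), `[Q(g)] = (2ij)•[box(g, g^{1/(2ij)})]`
(box stacking, landed `toric_pow`), and `FormalRep ⧸ relations` is torsion-free. [folklore] -/
theorem stub_triToBox : ((∀ (a b c : ℝ) (i j : ℕ), 0 < a → 0 < b → IsAlgebraic ℚ a → IsAlgebraic ℚ b → IsAlgebraic ℚ c → 1 ≤ i → 1 ≤ j → ∃ r : KZ.IntegralRep 3, r.domain = {p : Fin 3 → ℝ | a < p 0 ∧ b < p 1 ∧ p 0 ^ i * p 1 ^ j < c ∧ 0 < p 2 ∧ p 2 * (p 0 * p 1) < 1} ∧ r.integrand = fun _ => 1) ∧ (∀ g : ℝ, IsAlgebraic ℚ g → ∃ r : KZ.IntegralRep 3, r.domain = {p : Fin 3 → ℝ | 1 < p 1 ∧ p 1 < p 0 ∧ p 0 < g ∧ 0 < p 2 ∧ p 2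 * (p 0 * p 1) < 1} ∧ r.integrand = fun _ => 1) ∧ (∀ g : ℝ, IsAlgebraic ℚ g → ∃ r : KZ.IntegralRep 3, r.domain = {p : Fin 3 → ℝ | 0 < p 0 ∧ p 0 < g ∧ p 1 < g ∧ g < p 0 * p 1 ∧ 0 < p 2 ∧ p 2 * (p 0 * p 1) < 1} ∧ r.integrand = fun _ => 1)) → (∀ (i j : ℕ), 1 ≤ i → 1 ≤ j → ∀ (r r' : KZ.IntegralRep 3), r.domain ⊆ {p | 0 < p 0 ∧ 0 < p 1} → r'.domain ⊆ {p | 0 < p 0 ∧ 0 < p 1} → (∀ p : Fin 3 → ℝ, 0 < p 0 → 0 < p 1 → (p ∈ r.domain ↔ (![p 0 ^ i, p 1 ^ j, p 2 * (p 0 * p 1) / (p 0 ^ i * p 1 ^ j)] : Fin 3 → ℝ) ∈ r'.domain)) → (∀ p ∈ r.domain, r.integrand p = 1) → (∀ p ∈ r'.domain, r'.integrand p = 1) → KZ.of r' - (i * j) • KZ.of r ∈ KZ.relations) → ((∀ (A : ℝ), 0 < A → IsAlgebraic ℚ A → ∀ (r r' : KZ.IntegralRep 3), r.domain ⊆ {p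 | 0 < p 0} → r'.domain ⊆ {p | 0 < p 0} → (∀ p : Fin 3 → ℝ, 0 < p 0 → (p ∈ r.domain ↔ (![A / p 0, p 1, p 2 * p 0 ^ 2 / A] : Fin 3 → ℝ) ∈ r'.domain)) → (∀ p ∈ r.domain, r.integrand p = 1) → (∀ p ∈ r'.domain, r'.integrand p = 1) → KZ.of r - KZ.of r' ∈ KZ.relations) ∧ (∀ (A : ℝ), 0 < A → IsAlgebraic ℚ A → ∀ (r r' : KZ.IntegralRep 3), r.domain ⊆ {p | 0 < p 1} → r'.domain ⊆ {p | 0 < p 1} → (∀ p : Fin 3 → ℝ, 0 < p 1 → (p ∈ r.domain ↔ (![p 0, A / p 1, p 2 * p 1 ^ 2 / A] : Fin 3 → ℝ) ∈ r'.domain)) → (∀ p ∈ r.domain, r.integrand p = 1) → (∀ p ∈ r'.domain, r'.integrand p = 1) → KZ.of r - KZ.of r' ∈ KZ.relations)) → (∀ (g : ℝ), 1 < g → ∀ (r r₁ r₂ : KZ.IntegralRep 3), r.domain = {p : Fin 3 → ℝ | 1 < p 0 ∧ p 0 < g ∧ 1 < p 1 ∧ p 1 < g ∧ 0 < p 2 ∧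 p 2 * (p 0 * p 1) < 1} → r₁.domain = {p : Fin 3 → ℝ | 1 < p 0 ∧ 1 < p 1 ∧ p 0 ^ 1 * p 1 ^ 1 < g ∧ 0 < p 2 ∧ p 2 * (p 0 * p 1) < 1} → r₂.domain = {p : Fin 3 → ℝ | 0 < p 0 ∧ p 0 < g ∧ p 1 < g ∧ g < p 0 * p 1 ∧ 0 < p 2 ∧ p 2 * (p 0 * p 1) < 1} → (∀ p ∈ r.domain, r.integrand p = 1) → (∀ p ∈ r₁.domain, r₁.integrand p = 1) → (∀ p ∈ r₂.domain, r₂.integrand p = 1) → KZ.of r - KZ.of r₁ - KZ.of r₂ ∈ KZ.relations) → (∀ (a b c : ℝ) (i j : ℕ), 0 < a → 0 < b → IsAlgebraic ℚ a → IsAlgebraic ℚ b → IsAlgebraic ℚ c → 1 ≤ i → 1 ≤ j → a ^ i * b ^ j < c → ∀ (r r' : KZ.IntegralRep 3), r.domain = {p : Fin 3 → ℝ | a < p 0 ∧ b < p 1 ∧ p 0 ^ i * p 1 ^ j < c ∧ 0 < p 2 ∧ p 2 * (p 0 * p 1) < 1} → r'.domain = {p : Fin (2 + 1) → ℝ | (∀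 ι : Fin 2, (![a, b]) ι < p (Fin.castSucc ι) ∧ p (Fin.castSucc ι) < (fun ι => ![a, b] ι * ![c / (a ^ i * b ^ j), (c / (a ^ i * b ^ j)) ^ (((2 * i * j : ℕ) : ℝ)⁻¹)] ι) ι) ∧ 0 < p (Fin.last 2) ∧ p (Fin.last 2) * ∏ ι : Fin 2, p (Fin.castSucc ι) < 1} → (∀ p ∈ r.domain, r.integrand p = 1) → (∀ p ∈ r'.domain, r'.integrand p = 1) → KZ.of r - KZ.of r' ∈ KZ.relations) := by
  intro hEx3 hPow hInv hSplit a b c i j ha hb haa hba hca hi hj hlt r r' hrd hr'd hr hr'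
  -- the parameters
  have hP : 0 < a ^ i * b ^ j := by positivity
  set g : ℝ := c / (a ^ i * b ^ j) with hg
  have hg1 : 1 < g := (one_lt_div hP).mpr hlt
  have hg0 : 0 < g := one_pos.trans hg1
  have hga : IsAlgebraic ℚ g := ttb_isAlgebraic_ratio haa hba hca i j
  set Nn : ℕ := 2 * i * j with hNn
  have hN0 : Nn ≠ 0 := by positivity
  set γ : ℝ := g ^ ((Nn : ℝ)⁻¹) with hγ
  have hγ1 : 1 < γ := Real.one_lt_rpow hg1 (by positivity)
  have hγ0 : 0 < γ := one_pos.trans hγ1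
  have hγN : γ ^ Nn = g := Real.rpow_inv_natCast_pow hg0.le hN0
  have hγa : IsAlgebraic ℚ γ := IsAlgebraic.of_pow (Nat.pos_of_ne_zero hN0) (by rw [hγN]; exact hga)
  -- integrand-one bookkeeping
  have hio : ∀ {s : KZ.IntegralRep 3}, (s.integrand = fun _ => 1) → ∀ p ∈ s.domain, s.integrand p = 1 :=
    fun h p _ => by rw [h]
  -- the representations supplied by `stub_triExists`
  obtain ⟨T₁, hT₁d, hT₁i⟩ := hEx3.1 1 1 g i j one_pos one_pos isAlgebraic_one isAlgebraic_one hga hi hj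
  obtain ⟨T₂, hT₂d, hT₂i⟩ :=
    hEx3.1 1 1 g 1 1 one_pos one_pos isAlgebraic_one isAlgebraic_one hga le_rfl le_rfl
  obtain ⟨Md, hMdd, hMdi⟩ := hEx3.2.1 g hga
  obtain ⟨NE, hNEd, hNEi⟩ := hEx3.2.2 g hga
  -- the log-square and the target-shaped box, supplied by `stub_logBoxCut`
  have hcγ : ∀ ι, IsAlgebraic ℚ ((![g, γ] : Fin 2 → ℝ) ι) := by
    intro ι; fin_cases ι
    · simpa using hga
    · simpa using hγa
  obtain ⟨Q, hQd, hQi⟩ := stub_logBoxCut.1 2 (fun _ => (1:ℝ)) (Function.update ![g, γ] 1 (γ ^ Nn))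
    (fun _ => one_pos) (fun _ => isAlgebraic_one) (toric_update_algebraic hcγ 1 (hγa.pow Nn))
  obtain ⟨B₁, hB₁d, hB₁i⟩ := stub_logBoxCut.1 2 (fun _ => (1:ℝ)) (Function.update ![g, γ] 1 γ)
    (fun _ => one_pos) (fun _ => isAlgebraic_one) (toric_update_algebraic hcγ 1 hγa)
  -- Step 1: normalise the triangle to the corner (1, 1) by `diag(a, b, (ab)⁻¹)`
  have h1 : KZ.of T₁ - KZ.of r ∈ KZ.relations := by
    refine ttb_diag_move ![a, b, (a * b)⁻¹] ?_ ?_ ?_ T₁ r ?_ (hio hT₁i) hr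
    · intro k; fin_cases k
      · simpa using ha.ne'
      · simpa using hb.ne'
      · simp [ha.ne', hb.ne']
    · intro k; fin_cases k
      · simpa using haa
      · simpa using hba
      · simpa using (haa.mul hba).inv
    · rw [Fin.prod_univ_three]
      simp only [Matrix.cons_val_zero, Matrix.cons_val_one, Matrix.head_cons, Matrix.cons_val_two,
        Matrix.tail_cons]
      rw [mul_inv_cancel₀ (mul_pos ha hb).ne', abs_one]
    · rw [hrd, hT₁d]
      ext q
      simp only [mem_setOf_eq, Matrix.cons_val_zero, Matrix.cons_val_one, Matrix.head_cons,
        Matrix.cons_val_two, Matrix.tail_cons, inv_inv]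
      have e1 : 1 < a⁻¹ * q 0 ↔ a < q 0 := by rw [lt_inv_mul_iff₀ ha, mul_one]
      have e2 : 1 < b⁻¹ * q 1 ↔ b < q 1 := by rw [lt_inv_mul_iff₀ hb, mul_one]
      have e3 : (a⁻¹ * q 0) ^ i * (b⁻¹ * q 1) ^ j < g ↔ q 0 ^ i * q 1 ^ j < c := by
        have : (a⁻¹ * q 0) ^ i * (b⁻¹ * q 1) ^ j = (q 0 ^ i * q 1 ^ j) / (a ^ i * b ^ j) := by
          rw [mul_pow, mul_pow, inv_pow, inv_pow]
          field_simp
        rw [this, hg, div_lt_div_iff_of_pos_right hP]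
      have e4 : 0 < a * b * q 2 ↔ 0 < q 2 := mul_pos_iff_of_pos_left (mul_pos ha hb)
      have e5 : a * b * q 2 * (a⁻¹ * q 0 * (b⁻¹ * q 1)) = q 2 * (q 0 * q 1) := by
        field_simp
      rw [e1, e2, e3, e4, e5]
  -- Step 2: the power move `(x, y) ↦ (xⁱ, yʲ)`: `[T(1,1,1,1,g)] = (ij) • [T(1,1,i,j,g)]`
  have h2 : KZ.of T₂ - (i * j) • KZ.of T₁ ∈ KZ.relations := by
    refine hPow i j hi hj T₁ T₂ ?_ ?_ (fun p hp0 hp1 => ?_) (hio hT₁i) (hio hT₂i)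
    · rw [hT₁d]
      rintro p ⟨h0, h1', -⟩
      exact ⟨one_pos.trans h0, one_pos.trans h1'⟩
    · rw [hT₂d]
      rintro p ⟨h0, h1', -⟩
      exact ⟨one_pos.trans h0, one_pos.trans h1'⟩
    · rw [hT₁d, hT₂d]
      simp only [mem_setOf_eq, Matrix.cons_val_zero, Matrix.cons_val_one, Matrix.head_cons,
        Matrix.cons_val_two, Matrix.tail_cons, pow_one]
      have hD : 0 < p 0 ^ i * p 1 ^ j := by positivity
      have f1 : 1 < p 0 ^ i ↔ 1 < p 0 := one_lt_pow_iff_of_nonneg hp0.le (by omega)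
      have f2 : 1 < p 1 ^ j ↔ 1 < p 1 := one_lt_pow_iff_of_nonneg hp1.le (by omega)
      have f4 : 0 < p 2 * (p 0 * p 1) / (p 0 ^ i * p 1 ^ j) ↔ 0 < p 2 := by
        rw [div_pos_iff_of_pos_right hD, mul_pos_iff_of_pos_right (mul_pos hp0 hp1)]
      have f5 : p 2 * (p 0 * p 1) / (p 0 ^ i * p 1 ^ j) * (p 0 ^ i * p 1 ^ j) = p 2 * (p 0 * p 1) :=
        div_mul_cancel₀ _ hD.ne'
      rw [f1, f2, f4, f5]
  -- Step 3: the log-square splits along `xy = g`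
  have hl2 : (Fin.last 2 : Fin 3) = 2 := rfl
  have hu0 : ∀ t : ℝ, Function.update (![g, γ] : Fin 2 → ℝ) 1 t 0 = g := fun t => by
    rw [Function.update_of_ne (by decide)]; rfl
  have hu1 : ∀ t : ℝ, Function.update (![g, γ] : Fin 2 → ℝ) 1 t 1 = t := fun t => by
    rw [Function.update_self]
  have hQ' : Q.domain = {p : Fin 3 → ℝ | 1 < p 0 ∧ p 0 < g ∧ 1 < p 1 ∧ p 1 < g ∧
      0 < p 2 ∧ p 2 * (p 0 * p 1) < 1} := by
    rw [hQd]
    ext p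
    simp only [mem_setOf_eq, Fin.forall_fin_two, Fin.prod_univ_two, Fin.castSucc_zero,
      Fin.castSucc_one, hl2, hu0, hu1, hγN, and_assoc]
  have h3 : KZ.of Q - KZ.of T₂ - KZ.of NE ∈ KZ.relations :=
    hSplit g hg1 Q T₂ NE hQ' hT₂d hNEd (hio hQi) (hio hT₂i) (hio hNEi)
  -- Step 4: first inversion `x ↦ g/x`: `[T(1,1,1,1,g)] = [MID(g)]`
  have h4 : KZ.of T₂ - KZ.of Md ∈ KZ.relations := by
    refine hInv.1 g hg0 hga T₂ Md ?_ ?_ (fun p hp0 => ?_) (hio hT₂i) (hio hMdi)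
    · rw [hT₂d]
      rintro p ⟨h0, -⟩
      exact one_pos.trans h0
    · rw [hMdd]
      rintro p ⟨h1', h10, -⟩
      exact one_pos.trans (h1'.trans h10)
    · rw [hT₂d, hMdd]
      simp only [mem_setOf_eq, Matrix.cons_val_zero, Matrix.cons_val_one, Matrix.head_cons,
        Matrix.cons_val_two, Matrix.tail_cons, pow_one]
      have f2 : p 1 < g / p 0 ↔ p 0 * p 1 < g := by rw [lt_div_iff₀ hp0, mul_comm]
      have f3 : g / p 0 < g ↔ 1 < p 0 := by
        rw [div_lt_iff₀ hp0]
        constructor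
        · intro h; nlinarith
        · intro h; nlinarith
      have f4 : 0 < p 2 * p 0 ^ 2 / g ↔ 0 < p 2 := by
        rw [div_pos_iff_of_pos_right hg0, mul_pos_iff_of_pos_right (pow_pos hp0 2)]
      have f5 : p 2 * p 0 ^ 2 / g * (g / p 0 * p 1) = p 2 * (p 0 * p 1) := by
        field_simp
      rw [f2, f3, f4, f5]
      tauto
  -- Step 5: second inversion `y ↦ g/y`: `[MID(g)] = [NE(g)]`
  have h5 : KZ.of Md - KZ.of NE ∈ KZ.relations := by
    refine hInv.2 g hg0 hga Md NE ?_ ?_ (fun p hp1 => ?_) (hio hMdi) (hio hNEi)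
    · rw [hMdd]
      rintro p ⟨h1', -⟩
      exact one_pos.trans h1'
    · rw [hNEd]
      rintro p ⟨h0, -, -, hgt, -⟩
      exact (mul_pos_iff_of_pos_left h0).mp (hg0.trans hgt)
    · rw [hMdd, hNEd]
      simp only [mem_setOf_eq, Matrix.cons_val_zero, Matrix.cons_val_one, Matrix.head_cons,
        Matrix.cons_val_two, Matrix.tail_cons]
      have f3 : g / p 1 < g ↔ 1 < p 1 := by
        rw [div_lt_iff₀ hp1]
        constructor
        · intro h; nlinarith
        · intro h; nlinarith
      have f4 : g < p 0 * (g / p 1) ↔ p 1 < p 0 := by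
        rw [mul_div_assoc', lt_div_iff₀ hp1]
        constructor
        · intro h; nlinarith
        · intro h; nlinarith
      have f5 : 0 < p 2 * p 1 ^ 2 / g ↔ 0 < p 2 := by
        rw [div_pos_iff_of_pos_right hg0, mul_pos_iff_of_pos_right (pow_pos hp1 2)]
      have f6 : p 2 * p 1 ^ 2 / g * (p 0 * (g / p 1)) = p 2 * (p 0 * p 1) := by
        field_simp
      rw [f3, f4, f5, f6]
      constructor
      · rintro ⟨h1', h10, h0g, hz, hzz⟩
        exact ⟨hp1.trans h10, h0g, h1', h10, hz, hzz⟩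
      · rintro ⟨-, h0g, h1', h10, hz, hzz⟩
        exact ⟨h1', h10, h0g, hz, hzz⟩
  -- Steps 6–8: in the quotient, `(2ij) • [T(1,1,i,j,g)] = [Q(g)] = (2ij) • [box]`, then divide
  set π := QuotientAddGroup.mk' KZ.relations with hπ
  have e2 : π (KZ.of T₂) = (i * j) • π (KZ.of T₁) := by
    rw [← map_nsmul]
    exact toric_mk_eq_iff.mpr h2
  have e3 : π (KZ.of Q) = π (KZ.of T₂) + π (KZ.of NE) := toric_mk_eq_add_of_sub_sub_mem h3
  have e4 : π (KZ.of T₂) = π (KZ.of Md) := toric_mk_eq_iff.mpr h4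
  have e5 : π (KZ.of Md) = π (KZ.of NE) := toric_mk_eq_iff.mpr h5
  have e7 : π (KZ.of Q) = Nn • π (KZ.of B₁) :=
    toric_pow stub_logBoxCut.1 stub_logBoxCut.2 stub_logBoxLinear.1 ![g, γ] hcγ 1 hγ1 hγa B₁ hB₁d
      (hio hB₁i) Nn Q hQd (hio hQi)
  have e8 : Nn • π (KZ.of T₁) = Nn • π (KZ.of B₁) := by
    rw [← e7, e3, ← e5, ← e4, ← two_nsmul, e2, ttb_two_nsmul_nsmul]
  have e9 : KZ.of T₁ - KZ.of B₁ ∈ KZ.relations := by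
    refine Summit.KontsevichZagierPeriods.MultiplicationAccessible.Negative.mem_relations_of_nsmul_mem_relations
      hN0 ?_
    rw [nsmul_sub]
    exact toric_mk_eq_iff.mp (by rw [map_nsmul, map_nsmul]; exact e8)
  -- Step 9: un-normalise the box to the corner (a, b) by the scaling move
  have hupd : Function.update (![g, γ] : Fin 2 → ℝ) 1 γ = ![g, γ] := by
    funext ι
    fin_cases ι
    · simp
    · simp
  have h9 : KZ.of B₁ - KZ.of r' ∈ KZ.relations := by
    refine stub_logBoxLinear.1 2 (fun _ => (1:ℝ)) (Function.update ![g, γ] 1 γ) ![a, b] ?_ ?_ B₁ r'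
      hB₁d ?_ (hio hB₁i) hr'
    · intro ι; fin_cases ι
      · simpa using ha
      · simpa using hb
    · intro ι; fin_cases ι
      · simpa using haa
      · simpa using hba
    · rw [hr'd, hupd]
      ext p
      simp only [mem_setOf_eq, mul_one]
  -- assemble
  have : KZ.of r - KZ.of r' =
      (KZ.of T₁ - KZ.of B₁) + (KZ.of B₁ - KZ.of r') - (KZ.of T₁ - KZ.of r) := by abel
  rw [this]
  exact KZ.relations.sub_mem (KZ.relations.add_mem e9 h9) h1

end Summit.KontsevichZagierPeriods.SymplecticScissors.LogPolytope

end
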